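import Mathlib
import HarnessLib
import Summits.Ventures.LatticeQCDFlow.Exactness.SU2MetropolisKickCovering
import Summits.Ventures.LatticeQCDFlow.Exactness.UniformKickDoubling
import Summits.Ventures.LatticeQCDFlow.Exactness.U1MetropolisLinkErgodic
import Summits.Ventures.LatticeQCDFlow.Exactness.LeapfrogHMCDoeblin

/-!
# The engine's `SU(2)` Metropolis kick dominates Lebesgue-through-the-chart near the identity: its N-hit link update is uniformly ergodic

HONEST FRAMING: exact (Metropolis-corrected) sampling algorithms for lattice gauge theory;
figures of merit are autocorrelation/cost numbers at stated couplings and volumes; no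
continuum-physics claim.

Venture `LatticeQCDFlow` (cell pub-lqcd), topic `Exactness`, FANOUT row 9 (eng-latcore, the
engine `latflow.core.updates.sweep_metropolis_ref/_c` and `sun_2d.sweep_metropolis` at `N = 2`:
the proposal is `U ← exp(X) U` with `X` traceless anti-Hermitian, `X = iA·σ`, where — reading the
code `d = step·(2u−1); d −= mean(d); X_diag = i d; X_01 = re + i·im` through the Pauli dictionary
`su2Coord` of `Balaban1983to89.B10Eq18SigmaSU2` (`X₀₀ = iA₂`, `X₀₁ = iA₀ + A₁`) — the coordinates
`A₀ = im`, `A₁ = re` are uniform on `(−s, s)` and `A₂ = (d₀ − d₁)/2` with `d₀, d₁` uniform on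
`(−s, s)`, all independent; `s = step`).  NEW WORK of the cell over the tree
(`SU2MetropolisKickCovering.lean`: on `SU(2)` a step law dominating `c • (d³A|_{|A|<r}) ∘ (exp i·σ)⁻¹`
makes the N-hit link Metropolis uniformly ergodic; `UniformKickDoubling.lean`:
`smul_restrict_ball_le_conv`, `smul_conv_smul`; `U1ExpChartMinorisation.lean`:
`map_mul_restrict_ball_real`; `U1MetropolisLinkErgodic.lean`: `map_neg_restrict_ball`;
`LeapfrogHMCDoeblin.lean`: `smul_pi_le_pi`; `SU2ExpChartMinorisation.lean`: `expPauli_neg`).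
Nothing here is cited as a fact.

* §1 the one-dimensional laws: `boxUniform s` (uniform on `|x| < s`: probability, symmetric) and
  **`triangular s`** `= law of (d₀ − d₁)/2`, `d₀, d₁ ∼ boxUniform s` independent (probability;
  symmetric — negation is the swap `d₀ ↔ d₁`; `triangular_eq_map_conv` — it is the additive
  convolution `boxUniform ∗ boxUniform` halved, `−d₁ ∼ d₁`; **`smul_restrict_ball_le_triangular`** —
  it dominates `((2s)⁻² s) •` Lebesgue on `|x| < 3s/4`).
* §2 the coordinate law `su2KickCoordLaw s` on `ℝ³` (product of the three, moved to
  `EuclideanSpace ℝ (Fin 3)` by `toLp`) and **`su2MetropolisKick s = su2KickCoordLaw s ∘ (exp i·σ)⁻¹`**,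
  THE ENGINE'S PROPOSAL LAW ON `SU(2)`: a probability law (`isProbabilityMeasure_su2MetropolisKick`),
  inversion invariant (`isInvInvariant_su2MetropolisKick`: `exp(−iA·σ) = exp(iA·σ)⁻¹` and the
  coordinate law is symmetric), and **`smul_map_restrict_ball_le_su2MetropolisKick`** — it
  dominates `c(s) • (d³A|_{|A|<r(s)}) ∘ (exp i·σ)⁻¹` with `r(s) = min(3s/4, π)`, `c(s) ≠ 0`
  (`restrict_ball_le_map_toLp_pi`: the Euclidean ball lies in the coordinate box;
  `su2KickConst s = ∏ᵢ su2KickCoeffs s i`).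
* §3 **`su2MetropolisKick_uniformlyErgodic`** — for every kick size `s > 0` and every measurable
  weight pinched `0 < m ≤ p ≤ M` there are `k` and `ε ∈ (0, 1]` with
  `|μ₀(K^k)ᵗ(A) − (Z⁻¹p·Haar)(A)| ≤ (1 − ε)ᵗ` for every initial law, `K = symMH (mulWalk
  (su2MetropolisKick s)) p` the engine's link update, and `Z⁻¹ p · Haar` is the only probability
  law invariant under ONE hit; **`su2MetropolisKick_uniformlyErgodic_of_continuous`** — in
  particular for every continuous positive weight (the conditional Wilson weight
  `exp(β/2 · Re tr(U R†))` of a link given its staples is one).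

NOT CLAIMED: a count of hits or a rate (compactness); the sweep over links at fixed `nhit`; `SU(3)`
(the `N = 3` proposal has `8` coordinates and no chart density in the tree); floating point.
-/

noncomputable section

namespace Summit.Ventures.LatticeQCDFlow.Exactness

open MeasureTheory ProbabilityTheory Set Filter Topology Function Metric
open Literature.MathematicalPhysics.QuantumFieldTheory (haarProbability)
open Literature.MathematicalPhysics.QuantumFieldTheory.Balaban1983to89.B10Eq18SigmaSU2Haar
  (expPauli measurable_expPauli continuous_expPauli)
open scoped ENNReal

/-! ## §1 The one-dimensional coordinate laws -/

section OneDim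

/-- The uniform probability law on `|x| < s` (`step·(2u − 1)`, `u` uniform on `[0, 1)`). -/
def boxUniform (s : ℝ) : Measure ℝ := (ENNReal.ofReal (2 * s))⁻¹ • volume.restrict (ball (0 : ℝ) s)

/-- `boxUniform s` is a probability law for `s > 0`. -/
theorem isProbabilityMeasure_boxUniform {s : ℝ} (hs : 0 < s) : IsProbabilityMeasure (boxUniform s) := by
  have h2s : ENNReal.ofReal (2 * s) ≠ 0 := by
    rw [Ne, ENNReal.ofReal_eq_zero, not_le]; positivity
  exact ⟨by rw [boxUniform, Measure.smul_apply, Measure.restrict_apply_univ, Real.volume_ball, smul_eq_mul,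
    ENNReal.inv_mul_cancel h2s ENNReal.ofReal_ne_top]⟩

/-- `boxUniform s` is s-finite. -/
instance sFinite_boxUniform (s : ℝ) : SFinite (boxUniform s) := by
  unfold boxUniform; infer_instance

/-- `boxUniform s` is symmetric under `x ↦ −x`. -/
instance isNegInvariant_boxUniform (s : ℝ) : (boxUniform s).IsNegInvariant := by
  refine ⟨?_⟩
  rw [Measure.neg, boxUniform, Measure.map_smul, map_neg_restrict_ball]

/-- **The law of `(d₀ − d₁)/2`** for `d₀, d₁` independent uniform on `|x| < s` (the mean-subtracted
diagonal of the engine's proposal at `N = 2`). -/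
def triangular (s : ℝ) : Measure ℝ :=
  ((boxUniform s).prod (boxUniform s)).map fun q : ℝ × ℝ => 2⁻¹ * (q.1 - q.2)

/-- The halved difference is measurable. -/
theorem measurable_halfSub : Measurable fun q : ℝ × ℝ => (2 : ℝ)⁻¹ * (q.1 - q.2) :=
  (measurable_fst.sub measurable_snd).const_mul _

/-- `triangular s` is a probability law for `s > 0`. -/
theorem isProbabilityMeasure_triangular {s : ℝ} (hs : 0 < s) : IsProbabilityMeasure (triangular s) := by
  haveI := isProbabilityMeasure_boxUniform hs
  unfold triangular
  exact Measure.isProbabilityMeasure_map measurable_halfSub.aemeasurable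

/-- `triangular s` is s-finite. -/
instance sFinite_triangular (s : ℝ) : SFinite (triangular s) := by
  unfold triangular; infer_instance

/-- **`triangular s` is symmetric**: negating `(d₀ − d₁)/2` is swapping `d₀ ↔ d₁`, which preserves
the product law. -/
instance isNegInvariant_triangular (s : ℝ) : (triangular s).IsNegInvariant := by
  refine ⟨?_⟩
  rw [Measure.neg, triangular, Measure.map_map measurable_neg measurable_halfSub]
  have hcomp : (Neg.neg ∘ fun q : ℝ × ℝ => (2 : ℝ)⁻¹ * (q.1 - q.2)) =
      (fun q : ℝ × ℝ => (2 : ℝ)⁻¹ * (q.1 - q.2)) ∘ Prod.swap := by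
    funext q
    simp only [comp_apply, Prod.fst_swap, Prod.snd_swap]
    ring
  rw [hcomp, ← Measure.map_map measurable_halfSub measurable_swap, Measure.prod_swap]

/-- **`triangular s` is the additive convolution `boxUniform s ∗ boxUniform s`, halved** (`−d₁ ∼ d₁`). -/
theorem triangular_eq_map_conv (s : ℝ) :
    triangular s = ((boxUniform s) ∗ (boxUniform s)).map fun x : ℝ => 2⁻¹ * x := by
  have hcomp : (fun q : ℝ × ℝ => (2 : ℝ)⁻¹ * (q.1 - q.2)) =
      (fun x : ℝ => 2⁻¹ * x) ∘ ((fun q : ℝ × ℝ => q.1 + q.2) ∘ Prod.map id Neg.neg) := by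
    funext q
    simp only [comp_apply, Prod.map_fst, Prod.map_snd, id_eq]
    ring
  have hprod : ((boxUniform s).prod (boxUniform s)).map (Prod.map id Neg.neg) =
      (boxUniform s).prod (boxUniform s) := by
    rw [← Measure.map_prod_map _ _ measurable_id measurable_neg, Measure.map_id, Measure.map_neg_eq_self]
  rw [triangular, hcomp, ← Measure.map_map (measurable_const_mul _)
      (measurable_add.comp (measurable_id.prodMap measurable_neg)),
    ← Measure.map_map measurable_add (measurable_id.prodMap measurable_neg), hprod]
  rfl

/-- **`triangular s` dominates `((2s)⁻² s) •` Lebesgue on `|x| < 3s/4`**: the convolution of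
two uniforms on `|x| < s` dominates `(s/2) •` Lebesgue on `|x| < 3s/2` (`UniformKickDoubling`), and
halving doubles the density. -/
theorem smul_restrict_ball_le_triangular (s : ℝ) :
    ((ENNReal.ofReal (2 * s))⁻¹ ^ 2 * (ENNReal.ofReal (s / 2) * ENNReal.ofReal ((2 : ℝ)⁻¹⁻¹))) •
        volume.restrict (ball (0 : ℝ) (3 * s / 4)) ≤ triangular s := by
  rw [triangular_eq_map_conv, boxUniform, smul_conv_smul, ← pow_two, Measure.map_smul, mul_smul]
  refine measure_smul_le_smul_of_le ?_ _
  have h := Measure.map_mono (smul_restrict_ball_le_conv s) (measurable_const_mul (2 : ℝ)⁻¹)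
  rw [Measure.map_smul, map_mul_restrict_ball_real (by norm_num : (0 : ℝ) < 2⁻¹),
    show (2 : ℝ)⁻¹ * (3 * s / 2) = 3 * s / 4 by ring, smul_smul] at h
  exact h

/-- `boxUniform s` dominates `(2s)⁻¹ •` Lebesgue on any smaller ball. -/
theorem smul_restrict_ball_le_boxUniform {s r : ℝ} (hr : r ≤ s) :
    (ENNReal.ofReal (2 * s))⁻¹ • volume.restrict (ball (0 : ℝ) r) ≤ boxUniform s :=
  measure_smul_le_smul_of_le (Measure.restrict_mono (ball_subset_ball hr) le_rfl) _

end OneDim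

/-! ## §2 The coordinate law on `ℝ³` and the engine's kick law on `SU(2)` -/

section Kick

/-- The three coordinate laws: `A₀, A₁` uniform, `A₂` triangular. -/
def su2KickCoords (s : ℝ) : Fin 3 → Measure ℝ := ![boxUniform s, boxUniform s, triangular s]

/-- Each coordinate law is a probability law for `s > 0`. -/
theorem isProbabilityMeasure_su2KickCoords {s : ℝ} (hs : 0 < s) (i : Fin 3) :
    IsProbabilityMeasure (su2KickCoords s i) := by
  haveI := isProbabilityMeasure_boxUniform hs
  haveI := isProbabilityMeasure_triangular hs
  fin_cases i <;> simp [su2KickCoords] <;> infer_instance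

/-- Each coordinate law is s-finite (and σ-finite once a probability law). -/
instance sigmaFinite_su2KickCoords_of_pos (s : ℝ) [Fact (0 < s)] (i : Fin 3) :
    SigmaFinite (su2KickCoords s i) := by
  haveI := isProbabilityMeasure_su2KickCoords (Fact.out : 0 < s) i
  infer_instance

/-- Each coordinate law is symmetric. -/
theorem isNegInvariant_su2KickCoords (s : ℝ) (i : Fin 3) : (su2KickCoords s i).IsNegInvariant := by
  fin_cases i <;> simp [su2KickCoords] <;> infer_instance

/-- **The coordinate law of the engine's `SU(2)` proposal** on `ℝ³ = EuclideanSpace ℝ (Fin 3)`: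
independent `A₀, A₁ ∼` uniform, `A₂ ∼` triangular. -/
def su2KickCoordLaw (s : ℝ) [Fact (0 < s)] : Measure (EuclideanSpace ℝ (Fin 3)) :=
  (Measure.pi (su2KickCoords s)).map (WithLp.toLp 2)

/-- **THE ENGINE'S `SU(2)` METROPOLIS PROPOSAL LAW**: `exp(iA·σ)` with `A ∼ su2KickCoordLaw s`. -/
def su2MetropolisKick (s : ℝ) [Fact (0 < s)] : Measure (Matrix.specialUnitaryGroup (Fin 2) ℂ) :=
  (su2KickCoordLaw s).map expPauli

variable {s : ℝ} [Fact (0 < s)]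

/-- `toLp` is measurable. -/
theorem measurable_toLp3 : Measurable (WithLp.toLp 2 : (Fin 3 → ℝ) → EuclideanSpace ℝ (Fin 3)) :=
  (MeasurableEquiv.toLp 2 (Fin 3 → ℝ)).measurable

/-- The coordinate law is a probability law. -/
instance isProbabilityMeasure_su2KickCoordLaw : IsProbabilityMeasure (su2KickCoordLaw s) := by
  haveI := fun i => isProbabilityMeasure_su2KickCoords (Fact.out : 0 < s) i
  unfold su2KickCoordLaw
  exact Measure.isProbabilityMeasure_map measurable_toLp3.aemeasurable

/-- **The engine's kick law is a probability law.** -/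
instance isProbabilityMeasure_su2MetropolisKick : IsProbabilityMeasure (su2MetropolisKick s) := by
  unfold su2MetropolisKick
  exact Measure.isProbabilityMeasure_map measurable_expPauli.aemeasurable

/-- The coordinate law is symmetric under `A ↦ −A`. -/
theorem map_neg_su2KickCoordLaw : (su2KickCoordLaw s).map (fun A => -A) = su2KickCoordLaw s := by
  haveI := fun i => isProbabilityMeasure_su2KickCoords (Fact.out : 0 < s) i
  haveI := fun i => isNegInvariant_su2KickCoords s i
  have hneg : (fun A : EuclideanSpace ℝ (Fin 3) => -A) ∘ (WithLp.toLp 2 : (Fin 3 → ℝ) → _) =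
      (WithLp.toLp 2) ∘ fun x : Fin 3 → ℝ => -x := by
    funext x; rfl
  rw [su2KickCoordLaw, Measure.map_map measurable_neg measurable_toLp3, hneg,
    ← Measure.map_map measurable_toLp3 measurable_neg]
  congr 1
  exact (Measure.pi.isNegInvariant (su2KickCoords s)).neg_eq_self

/-- **The engine's kick law is inversion invariant** (`exp(−iA·σ) = exp(iA·σ)⁻¹`, symmetric
coordinates) — the symmetry hypothesis of Metropolis exactness (`mulWalkMH_invariant`). -/
instance isInvInvariant_su2MetropolisKick : (su2MetropolisKick s).IsInvInvariant := by
  refine ⟨?_⟩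
  have hcomp : (Inv.inv ∘ expPauli) = expPauli ∘ fun A : EuclideanSpace ℝ (Fin 3) => -A := by
    funext A
    simp only [comp_apply, expPauli_neg]
  rw [Measure.inv, su2MetropolisKick, Measure.map_map measurable_inv measurable_expPauli, hcomp,
    ← Measure.map_map measurable_expPauli measurable_neg, map_neg_su2KickCoordLaw]

/-- **The Euclidean ball lies in the coordinate box**: Lebesgue measure on `|A| < r` in `ℝ³` is
dominated by the image under `toLp` of the product of Lebesgue measures on `|x_i| < r`. -/
theorem restrict_ball_le_map_toLp_pi (r : ℝ) :
    (volume : Measure (EuclideanSpace ℝ (Fin 3))).restrict (ball 0 r) ≤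
      (Measure.pi fun _ : Fin 3 => (volume : Measure ℝ).restrict (ball 0 r)).map (WithLp.toLp 2) := by
  refine Measure.le_iff.2 fun F hF => ?_
  have hpi : (Measure.pi fun _ : Fin 3 => (volume : Measure ℝ).restrict (ball 0 r)) =
      (volume : Measure (Fin 3 → ℝ)).restrict (Set.pi univ fun _ => ball (0 : ℝ) r) := by
    rw [volume_pi, Measure.restrict_pi_pi]
  rw [hpi, Measure.map_apply measurable_toLp3 hF, Measure.restrict_apply (measurable_toLp3 hF),
    Measure.restrict_apply hF,
    ← (PiLp.volume_preserving_toLp (Fin 3)).measure_preimage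
      ((hF.inter measurableSet_ball).nullMeasurableSet)]
  refine measure_mono fun x hx => ⟨hx.1, ?_⟩
  have hball : WithLp.toLp 2 x ∈ ball (0 : EuclideanSpace ℝ (Fin 3)) r := hx.2
  rw [mem_ball_zero_iff] at hball
  refine Set.mem_univ_pi.2 fun i => mem_ball_zero_iff.2 ?_
  calc ‖x i‖ = ‖(WithLp.toLp 2 x : EuclideanSpace ℝ (Fin 3)) i‖ := rfl
    _ ≤ ‖(WithLp.toLp 2 x : EuclideanSpace ℝ (Fin 3))‖ := PiLp.norm_apply_le _ i
    _ < r := hball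

/-- The radius of the Lebesgue window the kick dominates: `min(3s/4, π)`. -/
def su2KickRadius (s : ℝ) : ℝ := min (3 * s / 4) Real.pi

/-- The coordinate-wise constants: `(2s)⁻¹, (2s)⁻¹, (2s)⁻² (s/2) 2`. -/
def su2KickCoeffs (s : ℝ) : Fin 3 → ℝ≥0∞ :=
  ![(ENNReal.ofReal (2 * s))⁻¹, (ENNReal.ofReal (2 * s))⁻¹,
    (ENNReal.ofReal (2 * s))⁻¹ ^ 2 * (ENNReal.ofReal (s / 2) * ENNReal.ofReal ((2 : ℝ)⁻¹⁻¹))]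

/-- The constant: the product of the coordinate-wise constants. -/
def su2KickConst (s : ℝ) : ℝ≥0∞ := ∏ i, su2KickCoeffs s i

omit [Fact (0 < s)] in
/-- `0 < su2KickRadius s ≤ π` for `s > 0`. -/
theorem su2KickRadius_pos (hs0 : 0 < s) : 0 < su2KickRadius s ∧ su2KickRadius s ≤ Real.pi :=
  ⟨lt_min (by linarith) Real.pi_pos, min_le_right _ _⟩

omit [Fact (0 < s)] in
/-- The constant is not zero for `s > 0`. -/
theorem su2KickConst_ne_zero (hs0 : 0 < s) : su2KickConst s ≠ 0 := by
  have h2s : (ENNReal.ofReal (2 * s))⁻¹ ≠ 0 := ENNReal.inv_ne_zero.2 ENNReal.ofReal_ne_top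
  have h1 : ENNReal.ofReal (s / 2) ≠ 0 := by rw [Ne, ENNReal.ofReal_eq_zero, not_le]; positivity
  have h2 : ENNReal.ofReal ((2 : ℝ)⁻¹⁻¹) ≠ 0 := by
    rw [Ne, ENNReal.ofReal_eq_zero, not_le]; norm_num
  refine Finset.prod_ne_zero_iff.2 fun i _ => ?_
  fin_cases i
  · exact h2s
  · exact h2s
  · exact mul_ne_zero (pow_ne_zero _ h2s) (mul_ne_zero h1 h2)

/-- **THE ENGINE'S KICK DOMINATES LEBESGUE-THROUGH-THE-CHART NEAR THE IDENTITY**: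
`su2KickConst s • (d³A|_{|A| < su2KickRadius s}) ∘ (exp i·σ)⁻¹ ≤ su2MetropolisKick s`. -/
theorem smul_map_restrict_ball_le_su2MetropolisKick :
    su2KickConst s • ((volume : Measure (EuclideanSpace ℝ (Fin 3))).restrict
        (ball 0 (su2KickRadius s))).map expPauli ≤ su2MetropolisKick s := by
  have hs0 : 0 < s := Fact.out
  haveI := fun i => isProbabilityMeasure_su2KickCoords hs0 i
  have hr : su2KickRadius s ≤ 3 * s / 4 := min_le_left _ _
  have hrs : su2KickRadius s ≤ s := hr.trans (by linarith)
  -- coordinate-wise minorants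
  have hcoord : ∀ i : Fin 3, su2KickCoeffs s i •
      (volume : Measure ℝ).restrict (ball 0 (su2KickRadius s)) ≤ su2KickCoords s i := by
    intro i
    fin_cases i
    · exact smul_restrict_ball_le_boxUniform hrs
    · exact smul_restrict_ball_le_boxUniform hrs
    · exact (measure_smul_le_smul_of_le (Measure.restrict_mono (ball_subset_ball hr) le_rfl) _).trans
        (smul_restrict_ball_le_triangular s)
  have hpi : su2KickConst s • (Measure.pi fun _ : Fin 3 =>
      (volume : Measure ℝ).restrict (ball 0 (su2KickRadius s))) ≤ Measure.pi (su2KickCoords s) :=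
    smul_pi_le_pi hcoord
  rw [su2MetropolisKick, su2KickCoordLaw, ← Measure.map_smul]
  refine Measure.map_mono ?_ measurable_expPauli
  calc su2KickConst s • (volume : Measure (EuclideanSpace ℝ (Fin 3))).restrict (ball 0 (su2KickRadius s))
      ≤ su2KickConst s • (Measure.pi fun _ : Fin 3 =>
          (volume : Measure ℝ).restrict (ball 0 (su2KickRadius s))).map (WithLp.toLp 2) :=
        measure_smul_le_smul_of_le (restrict_ball_le_map_toLp_pi _) _
    _ = ((su2KickConst s) • Measure.pi fun _ : Fin 3 =>
          (volume : Measure ℝ).restrict (ball 0 (su2KickRadius s))).map (WithLp.toLp 2) :=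
        (Measure.map_smul _ _ _).symm
    _ ≤ (Measure.pi (su2KickCoords s)).map (WithLp.toLp 2) := Measure.map_mono hpi measurable_toLp3

end Kick

/-! ## §3 The engine's N-hit `SU(2)` link Metropolis is uniformly ergodic -/

section Engine

variable {s : ℝ} [Fact (0 < s)] {p : Matrix.specialUnitaryGroup (Fin 2) ℂ → ℝ} {m M : ℝ}

/-- **THE ENGINE'S N-HIT `SU(2)` LINK METROPOLIS IS UNIFORMLY ERGODIC.**  For every kick size
`s > 0` and every measurable weight pinched `0 < m ≤ p ≤ M` (the other links frozen) there are `k`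
and `ε ∈ (0, 1]` with `|μ₀(K^k)ᵗ(A) − (Z⁻¹p·Haar)(A)| ≤ (1 − ε)ᵗ` for every initial law `μ₀`, every
`t`, every `A`, where `K = symMH (mulWalk (su2MetropolisKick s)) p`; and `Z⁻¹ p · Haar` is the ONLY
probability law invariant under one hit. -/
theorem su2MetropolisKick_uniformlyErgodic (hp : Measurable p) (hm : 0 < m) (hpm : ∀ x, m ≤ p x)
    (hpM : ∀ x, p x ≤ M) :
    ∃ k : ℕ, ∃ ε : ℝ, 0 < ε ∧ ε ≤ 1 ∧
      (∀ (μ₀ : Measure (Matrix.specialUnitaryGroup (Fin 2) ℂ)) [IsProbabilityMeasure μ₀] (t : ℕ)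
          (A : Set (Matrix.specialUnitaryGroup (Fin 2) ℂ)),
        |((fun m' : Measure (Matrix.specialUnitaryGroup (Fin 2) ℂ) =>
              m'.bind (nHit (symMH (mulWalk (su2MetropolisKick s)) p) k))^[t] μ₀).real A
            - (gibbsProbability (haarProbability (Matrix.specialUnitaryGroup (Fin 2) ℂ)) p).real A| ≤
          (1 - ε) ^ t) ∧
      ∀ (π' : Measure (Matrix.specialUnitaryGroup (Fin 2) ℂ)) [IsProbabilityMeasure π'],
        Kernel.Invariant (symMH (mulWalk (su2MetropolisKick s)) p) π' →
          π' = gibbsProbability (haarProbability (Matrix.specialUnitaryGroup (Fin 2) ℂ)) p :=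
  su2LinkMetropolis_uniformlyErgodic (su2KickRadius_pos (Fact.out : 0 < s)).1
    (su2KickRadius_pos (Fact.out : 0 < s)).2 (su2KickConst_ne_zero (Fact.out : 0 < s))
    smul_map_restrict_ball_le_su2MetropolisKick hp hm hpm hpM

/-- **… in particular for every continuous positive weight** (a continuous function on the compact
group is pinched): e.g. the conditional Wilson weight `U ↦ exp(β/2 · Re tr(U R†))` of a link given
its staple sum `R`. -/
theorem su2MetropolisKick_uniformlyErgodic_of_continuous (hp : Continuous p) (hp0 : ∀ U, 0 < p U) :
    ∃ k : ℕ, ∃ ε : ℝ, 0 < ε ∧ ε ≤ 1 ∧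
      (∀ (μ₀ : Measure (Matrix.specialUnitaryGroup (Fin 2) ℂ)) [IsProbabilityMeasure μ₀] (t : ℕ)
          (A : Set (Matrix.specialUnitaryGroup (Fin 2) ℂ)),
        |((fun m' : Measure (Matrix.specialUnitaryGroup (Fin 2) ℂ) =>
              m'.bind (nHit (symMH (mulWalk (su2MetropolisKick s)) p) k))^[t] μ₀).real A
            - (gibbsProbability (haarProbability (Matrix.specialUnitaryGroup (Fin 2) ℂ)) p).real A| ≤
          (1 - ε) ^ t) ∧
      ∀ (π' : Measure (Matrix.specialUnitaryGroup (Fin 2) ℂ)) [IsProbabilityMeasure π'],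
        Kernel.Invariant (symMH (mulWalk (su2MetropolisKick s)) p) π' →
          π' = gibbsProbability (haarProbability (Matrix.specialUnitaryGroup (Fin 2) ℂ)) p := by
  obtain ⟨U₀, -, hU₀⟩ := isCompact_univ.exists_isMinOn (univ_nonempty (α := Matrix.specialUnitaryGroup (Fin 2) ℂ))
    hp.continuousOn
  obtain ⟨U₁, -, hU₁⟩ := isCompact_univ.exists_isMaxOn (univ_nonempty (α := Matrix.specialUnitaryGroup (Fin 2) ℂ))
    hp.continuousOn
  exact su2MetropolisKick_uniformlyErgodic hp.measurable (hp0 U₀)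
    (fun x => (isMinOn_iff.1 hU₀) x (mem_univ x)) (fun x => (isMaxOn_iff.1 hU₁) x (mem_univ x))

end Engine

end Summit.Ventures.LatticeQCDFlow.Exactness
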